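import Summits.QuantumFields.YangMills.Theorems.BalabanUVNodesN15KingModelDualTorusRiemannLimit
import Summits.QuantumFields.YangMills.Theorems.BalabanUVNodesN15KingModelAliasSymbolContinuity
import Summits.QuantumFields.YangMills.Theorems.BalabanUVNodesN15KingModelGaussNormDeterminant
import HarnessLib

/-!
# BalabanUVNodes ∕ N15 — THE KING-MODEL RUNG (PART Ε-t): THE BLOCK-FIELD NORMALISATION PER SITE IN INFINITE VOLUME — `|Ω|⁻¹ln det Δ^{(K)} → (2π)^{−(d+1)}∫_{BZ} ln Δ^{(K)}(p′)dp′`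
# and `|Ω|⁻¹ln N_K → ½ln 2π − ½(2π)^{−(d+1)}∫_{BZ} ln Δ^{(K)}(p′)dp′` as the unit torus grows, at every RG step `K`; and THE CONTINUUM LIMIT `K → ∞` OF THESE DENSITIES EXISTS
# with King's rate `η² = L^{−2K}` (Cauchy from part Ε-o's volume-uniform rate)
# (Track A, DAG node N15 = NE2; FAN-OUT v1.1 §N15 s3 «KING-MODEL RUNG»; parts Ε-r (engine) + Ε-s (continuity) + Ε-n∕Ε-o∕Ε-p; count-neutral)

HONEST FRAMING.  Count-neutral (cell `pub-ymgap`, seat `pub-ymgap-dag-n15-e` g40; `--supports stmt-QuantumFields-27366 --as helper` = K3⁸).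
TEMPLATE LITERATURE: C. King, Commun. Math. Phys. **102** (1986) 649–677 [King1986], (3.89) p.668 («ln N_k = −½ ln det Δ^{(k)}»), (3.93) p.669 (the normalisations are
`O(#sites)` with two-spacing differences `≤ CL^{−2k}·#sites`), (4.5) p.670 (the symbol `Δ^{(k)}(p′)`), (4.35) p.674 (plane-wave sums over the dual torus).  King works at fixed
(periodic) volume with all estimates uniform in it; THIS FILE takes the volume to infinity in his free model.  §1 `tendsto_sum_symbol_sOf_div_card_of_continuousAt` (part Ε-r's
engine with the bound supplied by compactness of the zone).  §2 at fixed `N ≥ 1` fine sites per block side, `c = N²`, `a > 0`, `m² > 0`: ★★★ **`tendsto_sum_log_effSym_div_card`**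
(`|Ω_k|⁻¹Σ_{q∈Ω̂_k} ln effSym(q) → bzMean(ln Δ^{(K)}) = (2π)^{−(d+1)}∫_{(−π,π]^{d+1}} ln DeltaEff a N m² p′ dp′` along any tori with all periods `→ ∞`; `effSym = DeltaEff∘p′` is
the tree's `effSym_eq_DeltaEff`, continuity on the closed zone is part Ε-s), ★★★ **`tendsto_log_det_effLaplacian_div_card`** (part Ε-n's determinant), ★★★
**`tendsto_log_gaussNorm_effLaplacian_div_card`** (`|Ω_k|⁻¹ln N_K → ½ln 2π − ½·bzMean(ln Δ^{(K)})`, part Ε-p).  §3 in King's scaling `N = L^K`, `a = a_K`: ★★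
**`abs_log_det_div_card_sub_le_two_scales`** (`| |Ω|⁻¹ln det Δ^{(K)} − |Ω|⁻¹ln det Δ^{(K′)} | ≤ C′·(L^{−2K} + L^{−2K′})` uniformly in the volume, part Ε-o ×2), ★★
**`abs_bzMean_sub_bzMean_le`** (the same for the infinite-volume densities, limits preserve `≤`), ★★★ **`exists_tendsto_bzMean_log_DeltaEff`** — THE CONTINUUM LIMIT OF THE
INFINITE-VOLUME NORMALISATION DENSITY EXISTS: `∃ f_∞, bzMean(ln Δ^{(K)}) → f_∞` with `|bzMean(ln Δ^{(K)}) − f_∞| ≤ C′·L^{−2K}` for every `K ≥ 1` (`C′ = (a_∞⁻¹+m⁻²)·C_Δ(a)`).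

PRIOR TREE ART (used, not restated): part Ε-r (`bzMean`, `tendsto_sum_symbol_sOf_div_card`), part Ε-s (`continuousAt_log_DeltaEff`), `King1986` (`effSym_eq_DeltaEff`, `DeltaEff`, `aK`,
`aK_pos`), part Ε-n (`log_det_effLaplacian`), part Ε-o (`abs_log_det_div_card_sub_lim_le`), part Ε-p (`log_gaussNorm_effLaplacian`), part Τ-a (`gaussNorm`), Mathlib
(`IsCompact.exists_bound_of_continuousOn`, `cauchySeq_tendsto_of_complete`, `le_of_tendsto'`).  NOT Bałaban's covariant objects; NOT a node discharge (N15 is booked through n15-a's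
knit, untouched); nothing continuum-YM ∕ `ℝ⁴` ∕ OS ∕ Clay.  0 `sorry`, 0 `def`.

HONEST SCOPE.  King's `A = 0` free model; unit tori `Π_νℤ∕M_ν` (dimension `d+1`) with all `M_ν → ∞`; `N ≥ 1`, `c = N²`, `a > 0`, `m² > 0`; in §3 `L` odd `≥ 2`.  The limit `f_∞` of §3
is obtained by completeness (its identification with `bzMean(ln Δ^{(∞)})` would need the continuity of the infinite alias series `S_∞` on the zone, not typed here).  Locators:
[King1986] (3.89) p.668, (3.93) p.669, (4.5) p.670, (4.35) p.674.
-/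

noncomputable section

open scoped BigOperators Topology
open Finset Filter

namespace Summit.QuantumFields.YangMills.BalabanUVNodes.N15KingModelRung.TorusSpectral

open Literature.MathematicalPhysics.QuantumFieldTheory.Balaban1983to89.B5Prop11Plancherel (Tor sOf abs_sOf_le)
open Literature.MathematicalPhysics.QuantumFieldTheory.King1986 (aK aK_pos DeltaEff)
open Literature.MathematicalPhysics.QuantumFieldTheory.King1986.Torus
open Summit.QuantumFields.YangMills.BalabanUVNodes.N15KingModelRung.FreeField (gaussNorm)

variable {d : ℕ}

/-! ## §1 The engine with the bound from compactness -/

/-- part Ε-r's engine for a symbol continuous at every point of the closed zone (the bound `B` comes from compactness of `[−π,π]^{d+1}`). [cite: King1986, (4.35) p.674] -/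
theorem tendsto_sum_symbol_sOf_div_card_of_continuousAt (h : (Fin (d + 1) → ℝ) → ℝ) (hcont : ∀ p : Fin (d + 1) → ℝ, (∀ ν, |p ν| ≤ Real.pi) → ContinuousAt h p)
    (Mseq : ℕ → Fin (d + 1) → ℕ) (hpos : ∀ k ν, 0 < Mseq k ν) (hlim : ∀ ν, Tendsto (fun k => (Mseq k ν : ℝ)) atTop atTop) :
    Tendsto (fun k => haveI : ∀ ν, NeZero (Mseq k ν) := fun ν => ⟨(hpos k ν).ne'⟩
      (Fintype.card (Tor (Mseq k)) : ℝ)⁻¹ * ∑ q : Tor (Mseq k), h (sOf (Mseq k) q)) atTop (𝓝 (bzMean h d)) := by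
  have hOn : ContinuousOn h (Set.Icc (fun _ : Fin (d + 1) => -Real.pi) (fun _ => Real.pi)) :=
    fun p hp => (hcont p fun ν => abs_le.mpr ⟨hp.1 ν, hp.2 ν⟩).continuousWithinAt
  obtain ⟨C, hC⟩ := isCompact_Icc.exists_bound_of_continuousOn hOn
  refine tendsto_sum_symbol_sOf_div_card h (le_max_right C 0) (fun p hp => ?_) hcont Mseq hpos hlim
  have hmem : p ∈ Set.Icc (fun _ : Fin (d + 1) => -Real.pi) (fun _ => Real.pi) := ⟨fun ν => (hp ν).1.le, fun ν => (hp ν).2⟩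
  have := hC p hmem
  rw [Real.norm_eq_abs] at this
  exact this.trans (le_max_left _ _)

/-! ## §2 The block-field normalisation per site in infinite volume (fixed `N`, `c = N²`) -/

section FixedStep

variable (N : ℕ) [NeZero N]

/-- ★★★ **THE PLANE-WAVE SUM OF `ln Δ^{(K)}` PER SITE HAS A THERMODYNAMIC LIMIT**: along any tori `Π_νℤ∕M_{k,ν}` with all `M_{k,ν} → ∞`,
`|Ω_k|⁻¹Σ_{q∈Ω̂_k} ln effSym(q) → (2π)^{−(d+1)}∫_{(−π,π]^{d+1}} ln Δ^{(K)}(p′)dp′` (`N ≥ 1`, `c = N²`, `a > 0`, `m² > 0`). [cite: King1986, (4.5) p.670, (4.35) p.674, (3.89) p.668] -/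
theorem tendsto_sum_log_effSym_div_card (hN1 : 1 ≤ N) {a m2 : ℝ} (ha : 0 < a) (hm : 0 < m2) (Mseq : ℕ → Fin (d + 1) → ℕ) (hpos : ∀ k ν, 0 < Mseq k ν)
    (hlim : ∀ ν, Tendsto (fun k => (Mseq k ν : ℝ)) atTop atTop) :
    Tendsto (fun k => haveI : ∀ ν, NeZero (Mseq k ν) := fun ν => ⟨(hpos k ν).ne'⟩
      (Fintype.card (Tor (Mseq k)) : ℝ)⁻¹ * ∑ q : Tor (Mseq k), Real.log (effSym N (Mseq k) a ((N : ℝ) ^ 2) m2 q)) atTop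
      (𝓝 (bzMean (fun p : Fin (d + 1) → ℝ => Real.log (DeltaEff a N m2 p)) d)) := by
  refine (tendsto_sum_symbol_sOf_div_card_of_continuousAt (fun p : Fin (d + 1) → ℝ => Real.log (DeltaEff a N m2 p))
    (fun p hp => continuousAt_log_DeltaEff hN1 ha hm hp) Mseq hpos hlim).congr fun k => ?_
  haveI : ∀ ν, NeZero (Mseq k ν) := fun ν => ⟨(hpos k ν).ne'⟩
  congr 1
  exact Finset.sum_congr rfl fun q _ => by rw [effSym_eq_DeltaEff N (Mseq k) hN1 ha hm q]

/-- ★★★ **THE BLOCK-FIELD DETERMINANT PER SITE IN INFINITE VOLUME**: `|Ω_k|⁻¹ln det Δ^{(K)}_{Ω_k} → (2π)^{−(d+1)}∫_{(−π,π]^{d+1}} ln Δ^{(K)}(p′)dp′`. [cite: King1986, (3.89) p.668,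
(3.93) p.669, (4.5) p.670] -/
theorem tendsto_log_det_effLaplacian_div_card (hN1 : 1 ≤ N) {a m2 : ℝ} (ha : 0 < a) (hm : 0 < m2) (Mseq : ℕ → Fin (d + 1) → ℕ) (hpos : ∀ k ν, 0 < Mseq k ν)
    (hlim : ∀ ν, Tendsto (fun k => (Mseq k ν : ℝ)) atTop atTop) :
    Tendsto (fun k => haveI : ∀ ν, NeZero (Mseq k ν) := fun ν => ⟨(hpos k ν).ne'⟩
      (Fintype.card (Tor (Mseq k)) : ℝ)⁻¹ * Real.log (effLaplacian N (Mseq k) a ((N : ℝ) ^ 2) m2).det) atTop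
      (𝓝 (bzMean (fun p : Fin (d + 1) → ℝ => Real.log (DeltaEff a N m2 p)) d)) := by
  refine (tendsto_sum_log_effSym_div_card N hN1 ha hm Mseq hpos hlim).congr fun k => ?_
  haveI : ∀ ν, NeZero (Mseq k ν) := fun ν => ⟨(hpos k ν).ne'⟩
  rw [log_det_effLaplacian N (Mseq k) ha (by positivity) hm]

/-- ★★★ **THE BLOCK-FIELD NORMALISATION PER SITE IN INFINITE VOLUME**: `|Ω_k|⁻¹ln N_K → ½ln 2π − ½(2π)^{−(d+1)}∫_{(−π,π]^{d+1}} ln Δ^{(K)}(p′)dp′` (King's «ln N_k = −½ln det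
Δ^{(k)} + const» per site, the volume taken to infinity). [cite: King1986, (3.89) p.668, (3.93) p.669, (2.6) p.652] -/
theorem tendsto_log_gaussNorm_effLaplacian_div_card (hN1 : 1 ≤ N) {a m2 : ℝ} (ha : 0 < a) (hm : 0 < m2) (Mseq : ℕ → Fin (d + 1) → ℕ) (hpos : ∀ k ν, 0 < Mseq k ν)
    (hlim : ∀ ν, Tendsto (fun k => (Mseq k ν : ℝ)) atTop atTop) :
    Tendsto (fun k => haveI : ∀ ν, NeZero (Mseq k ν) := fun ν => ⟨(hpos k ν).ne'⟩
      (Fintype.card (Tor (Mseq k)) : ℝ)⁻¹ * Real.log (gaussNorm (effLaplacian N (Mseq k) a ((N : ℝ) ^ 2) m2))) atTop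
      (𝓝 (1 / 2 * Real.log (2 * Real.pi) - 1 / 2 * bzMean (fun p : Fin (d + 1) → ℝ => Real.log (DeltaEff a N m2 p)) d)) := by
  have h := tendsto_sum_log_effSym_div_card N hN1 ha hm Mseq hpos hlim
  refine ((tendsto_const_nhds (x := 1 / 2 * Real.log (2 * Real.pi))).sub (h.const_mul (1 / 2))).congr fun k => ?_
  haveI : ∀ ν, NeZero (Mseq k ν) := fun ν => ⟨(hpos k ν).ne'⟩
  have hcard : (Fintype.card (Tor (Mseq k)) : ℝ) ≠ 0 := by exact_mod_cast Fintype.card_ne_zero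
  rw [log_gaussNorm_effLaplacian N (Mseq k) ha (by positivity) hm, mul_sub]
  congr 1
  · field_simp
  · ring

end FixedStep

/-! ## §3 King's scaling `N = L^K`: the continuum limit of the infinite-volume densities -/

section Continuum

variable (L : ℕ)

/-- ★★ **TWO SCALES, UNIFORMLY IN THE VOLUME**: `| |Ω|⁻¹ln det Δ^{(K)} − |Ω|⁻¹ln det Δ^{(K′)} | ≤ C′·(L^{−2K} + L^{−2K′})` on every unit torus (`K, K′ ≥ 1`; part Ε-o against `Δ^{(∞)}` twice).
[cite: King1986, (3.93) p.669] -/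
theorem abs_log_det_div_card_sub_le_two_scales (M : Fin (d + 1) → ℕ) [∀ μ, NeZero (M μ)] (hLodd : Odd L) (hL : 2 ≤ L) {a m2 : ℝ} (ha : 0 < a) (hm : 0 < m2)
    {K K' : ℕ} (hK : 1 ≤ K) (hK' : 1 ≤ K') :
    haveI : NeZero L := ⟨by omega⟩
    |(Fintype.card (Tor M) : ℝ)⁻¹ * Real.log (effLaplacian (L ^ K) M (aK a L K) (((L ^ K : ℕ) : ℝ) ^ 2) m2).det
        - (Fintype.card (Tor M) : ℝ)⁻¹ * Real.log (effLaplacian (L ^ K') M (aK a L K') (((L ^ K' : ℕ) : ℝ) ^ 2) m2).det|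
      ≤ ((aInf a L)⁻¹ + m2⁻¹) * (8 / 3 * (a ^ 2 * (a⁻¹ + Real.pi ^ 2 / 48 + 1 / 3)) + 4 / 3 * a) * (((L : ℝ) ^ (2 * K))⁻¹ + ((L : ℝ) ^ (2 * K'))⁻¹) := by
  haveI : NeZero L := ⟨by omega⟩
  have h1 := abs_log_det_div_card_sub_lim_le L M hLodd hL ha hm hK
  have h2 := abs_log_det_div_card_sub_lim_le L M hLodd hL ha hm hK'
  rw [abs_sub_comm] at h2
  calc _ ≤ _ := abs_sub_le _ ((Fintype.card (Tor M) : ℝ)⁻¹ * Real.log (Matrix.of fun b b' => effLaplacianLim L M a m2 b b').det) _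
    _ ≤ _ := add_le_add h1 h2
    _ = _ := by ring

/-- ★★ **THE SAME IN INFINITE VOLUME**: `|bzMean(ln Δ^{(K)}) − bzMean(ln Δ^{(K′)})| ≤ C′·(L^{−2K} + L^{−2K′})` (limits along the cubes `(ℤ∕(k+1))^{d+1}` preserve `≤`). [cite: King1986, (3.93) p.669] -/
theorem abs_bzMean_sub_bzMean_le (hLodd : Odd L) (hL : 2 ≤ L) {a m2 : ℝ} (ha : 0 < a) (hm : 0 < m2) {K K' : ℕ} (hK : 1 ≤ K) (hK' : 1 ≤ K') :
    |bzMean (fun p : Fin (d + 1) → ℝ => Real.log (DeltaEff (aK a L K) (L ^ K) m2 p)) d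
        - bzMean (fun p : Fin (d + 1) → ℝ => Real.log (DeltaEff (aK a L K') (L ^ K') m2 p)) d|
      ≤ ((aInf a L)⁻¹ + m2⁻¹) * (8 / 3 * (a ^ 2 * (a⁻¹ + Real.pi ^ 2 / 48 + 1 / 3)) + 4 / 3 * a) * (((L : ℝ) ^ (2 * K))⁻¹ + ((L : ℝ) ^ (2 * K'))⁻¹) := by
  haveI : NeZero L := ⟨by omega⟩
  have hL1 : (1 : ℝ) < L := by exact_mod_cast (show 1 < L by omega)
  haveI : NeZero (L ^ K) := ⟨pow_ne_zero _ (NeZero.ne L)⟩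
  haveI : NeZero (L ^ K') := ⟨pow_ne_zero _ (NeZero.ne L)⟩
  -- the cubes `(ℤ∕(k+1))^{d+1}`
  set Mseq : ℕ → Fin (d + 1) → ℕ := fun k _ => k + 1 with hMseq
  have hpos : ∀ k ν, 0 < Mseq k ν := fun k ν => Nat.succ_pos k
  have hlim : ∀ ν : Fin (d + 1), Tendsto (fun k => (Mseq k ν : ℝ)) atTop atTop := fun ν => by
    simp only [hMseq]
    exact tendsto_natCast_atTop_atTop.comp (tendsto_add_atTop_nat 1)
  have hc : ∀ K : ℕ, (((L ^ K : ℕ) : ℝ) ^ 2) = ((L ^ K : ℕ) : ℝ) ^ 2 := fun K => rfl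
  have t1 := tendsto_log_det_effLaplacian_div_card (L ^ K) (Nat.one_le_pow _ _ (by omega)) (aK_pos ha hL1 hK) hm Mseq hpos hlim
  have t2 := tendsto_log_det_effLaplacian_div_card (L ^ K') (Nat.one_le_pow _ _ (by omega)) (aK_pos ha hL1 hK') hm Mseq hpos hlim
  refine le_of_tendsto' ((t1.sub t2).abs) fun k => ?_
  haveI : ∀ ν, NeZero (Mseq k ν) := fun ν => ⟨(hpos k ν).ne'⟩
  exact abs_log_det_div_card_sub_le_two_scales L (Mseq k) hLodd hL ha hm hK hK'

/-- ★★★ **THE CONTINUUM LIMIT OF THE INFINITE-VOLUME NORMALISATION DENSITY EXISTS, WITH KING's RATE**: for `L` odd `≥ 2`, `a, m² > 0` there is `f_∞` with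
`bzMean(ln Δ^{(K)}) → f_∞` as `K → ∞` and `|bzMean(ln Δ^{(K)}) − f_∞| ≤ C′·L^{−2K}` for every `K ≥ 1` (`C′ = (a_∞⁻¹+m⁻²)·C_Δ(a)`; Cauchy by the previous bound, completeness of ℝ).
[cite: King1986, (3.93) p.669, (3.89) p.668, Thm 3.4 (3.9) p.656] -/
theorem exists_tendsto_bzMean_log_DeltaEff (hLodd : Odd L) (hL : 2 ≤ L) {a m2 : ℝ} (ha : 0 < a) (hm : 0 < m2) :
    ∃ f : ℝ, Tendsto (fun K : ℕ => bzMean (fun p : Fin (d + 1) → ℝ => Real.log (DeltaEff (aK a L K) (L ^ K) m2 p)) d) atTop (𝓝 f) ∧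
      ∀ K : ℕ, 1 ≤ K → |bzMean (fun p : Fin (d + 1) → ℝ => Real.log (DeltaEff (aK a L K) (L ^ K) m2 p)) d - f|
        ≤ ((aInf a L)⁻¹ + m2⁻¹) * (8 / 3 * (a ^ 2 * (a⁻¹ + Real.pi ^ 2 / 48 + 1 / 3)) + 4 / 3 * a) * ((L : ℝ) ^ (2 * K))⁻¹ := by
  have hL1 : (1 : ℝ) < L := by exact_mod_cast (show 1 < L by omega)
  set b : ℕ → ℝ := fun K => bzMean (fun p : Fin (d + 1) → ℝ => Real.log (DeltaEff (aK a L K) (L ^ K) m2 p)) d with hb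
  set C : ℝ := ((aInf a L)⁻¹ + m2⁻¹) * (8 / 3 * (a ^ 2 * (a⁻¹ + Real.pi ^ 2 / 48 + 1 / 3)) + 4 / 3 * a) with hC
  have hC0 : 0 ≤ C := by have := aInf_pos ha hL1; positivity
  -- the rate sequence `r_K = L^{−2K} → 0`
  have hr : Tendsto (fun K : ℕ => ((L : ℝ) ^ (2 * K))⁻¹) atTop (𝓝 0) := by
    have h : Tendsto (fun K : ℕ => (((L : ℝ) ^ 2)⁻¹) ^ K) atTop (𝓝 0) :=
      tendsto_pow_atTop_nhds_zero_of_lt_one (by positivity) (inv_lt_one_of_one_lt₀ (by nlinarith))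
    refine h.congr fun K => ?_
    rw [inv_pow, pow_mul]
  have hbound : ∀ K K', 1 ≤ K → 1 ≤ K' → |b K - b K'| ≤ C * (((L : ℝ) ^ (2 * K))⁻¹ + ((L : ℝ) ^ (2 * K'))⁻¹) :=
    fun K K' hK hK' => abs_bzMean_sub_bzMean_le L hLodd hL ha hm hK hK'
  -- Cauchy
  have hcauchy : CauchySeq b := by
    refine Metric.cauchySeq_iff.2 fun ε hε => ?_
    have hev : ∀ᶠ K in atTop, C * ((L : ℝ) ^ (2 * K))⁻¹ < ε / 2 := by
      have := (hr.const_mul C)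
      rw [mul_zero] at this
      exact this.eventually (gt_mem_nhds (by positivity))
    obtain ⟨K₀, hK₀⟩ := (hev.and (eventually_ge_atTop 1)).exists_forall_of_atTop
    refine ⟨K₀, fun m hm' n hn => ?_⟩
    rw [Real.dist_eq]
    calc |b m - b n| ≤ C * (((L : ℝ) ^ (2 * m))⁻¹ + ((L : ℝ) ^ (2 * n))⁻¹) := hbound m n (hK₀ m hm').2 (hK₀ n hn).2
      _ = C * ((L : ℝ) ^ (2 * m))⁻¹ + C * ((L : ℝ) ^ (2 * n))⁻¹ := by ring
      _ < ε / 2 + ε / 2 := add_lt_add (hK₀ m hm').1 (hK₀ n hn).1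
      _ = ε := by ring
  obtain ⟨f, hf⟩ := cauchySeq_tendsto_of_complete hcauchy
  refine ⟨f, hf, fun K hK => ?_⟩
  -- the rate: let `K′ → ∞` in the two-scale bound
  have hlimK' : Tendsto (fun K' : ℕ => |b K - b K'|) atTop (𝓝 |b K - f|) := (tendsto_const_nhds.sub hf).abs
  have hlimR : Tendsto (fun K' : ℕ => C * (((L : ℝ) ^ (2 * K))⁻¹ + ((L : ℝ) ^ (2 * K'))⁻¹)) atTop (𝓝 (C * ((L : ℝ) ^ (2 * K))⁻¹)) := by
    have := (tendsto_const_nhds (x := ((L : ℝ) ^ (2 * K))⁻¹)).add hr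
    rw [add_zero] at this
    exact this.const_mul C
  exact le_of_tendsto_of_tendsto hlimK' hlimR (Filter.eventually_atTop.2 ⟨1, fun K' hK' => hbound K K' hK hK'⟩)

end Continuum

end Summit.QuantumFields.YangMills.BalabanUVNodes.N15KingModelRung.TorusSpectral

end
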